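import Literature.Analysis.FluidPDE.ForwardDSSExistenceLocal
import HarnessLib

/-!
# Forward DSS solutions: the architecture of Bradshaw–Tsai 2019, Proposition 3.1

Analysis/FluidPDE fact file, companion of `ForwardDSSExistence.lean` (the named fact
`Literature.Analysis.FluidPDE.bradshawTsai2019_prop_3_1`) and `ForwardDSSExistenceLocal.lean`
(its variant `bradshawTsai2019_prop_3_1_dss` recording the DSS invariance of the [BT1] pressure).
Those facts render

> **Bradshaw–Tsai, Analysis & PDE 12 (2019) = arXiv:1801.08060, Proposition 3.1.** Fix `λ > 1`.
> Assume `v₀ ∈ L³_w(ℝ³)` is `λ`-DSS and divergence-free, and `v` is a `λ`-DSS local Leray solution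
> evolving from `v₀` constructed in [BT1] (in particular, it is the limit of the mollified
> approximation scheme [BT1]) and `π` is its associated pressure. Let `α₀ = ‖v₀‖²_{L²(B_λ)}`. Then,
> there exist positive `T = T(α₀, λ)` and `C(α₀, λ)` independent of `‖v₀‖_{L²_uloc}` and
> `‖v₀‖_{L³_w}` so that `esssup_{0≤t≤T} ∫_{B₁}|v|² + ∫₀ᵀ∫_{B₁}|∇v|² < C(α₀, λ)` and
> `∫₀ᵀ∫_{B₁}|π|^{3/2} < C(α₀, λ)` [+ the pressure formula (3.3), omitted].

Discharging them needs the existence theory of [BT1] (Bradshaw–Tsai, Ann. Henri Poincaré 18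
(2017), Thm 1.2: Galerkin approximation of the mollified time-periodic Leray system, Stokes
uniqueness and Calderón–Zygmund bounds for the pressure) and the estimates (3.9)–(3.11) of the
printed proof (Gagliardo–Nirenberg, Young, Calderón–Zygmund on `L^{3/2}`), none of which Mathlib or
`Literature` has. This file records the **printed proof's architecture** (loc. cit. §3, arXiv
pp. 8–10) and **proves its elementary heart**:

* `BradshawTsai2019.continuity_argument` (**proved**): the continuity argument
  (3.13) ⇒ (3.14) — if `α` is continuous on `(0, ∞)` with right limit `≤ α₀ ≤ a` at `0` and
  `α(t) ≤ α₀ + C₀∫₀ᵗ(α̃³ + α̃)` for `0 < t ≤ 1` (`α̃` the running supremum), then `α ≤ 2a` on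
  `(0, T]` as soon as `C₀ T (2 + 8a²) < 1`, `T ≤ 1` ("By a continuity argument, we may take
  `T = (C(2 + 8α₀²))⁻¹`").
* `bradshawTsai2019_prop_3_1_scheme` (named fact, **not proved**): what the proof of Prop. 3.1
  takes from [BT1] and establishes about the mollified approximants before the continuity
  argument, *as printed on pp. 8–10*: the [BT1] solution `(v, π)` (a `λ`-DSS local Leray solution
  with `λ`-DSS pressure) is accompanied by approximants `v_ε` (`ε = ε_k → 0`) whose local energies
  `α_ε(t) = ∫_{B₁}|v_ε(t)|²` are continuous on `(0,∞)` and tend to `∫_{B₁}|v₀|²` as `t → 0⁺`, which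
  obey the local energy inequality **(3.12)**
  `α_ε(t) + ∫₀ᵗ∫_{B₁}|∇v_ε|² ≤ α₀ + C₀∫₀ᵗ(α̃_ε³ + α̃_ε) ds` and the pressure bound
  `∫₀ᵗ∫_{B₁}|π_ε|^{3/2} ≤ C₀(α₀ + ∫₀ᵗ(α̃_ε³ + α̃_ε) ds)` for `0 < t ≤ 1` with `C₀ = C(λ, η, γ)`, and
  whose bounds pass to the limit ("Letting `ε → 0` yields `(v, χ_{B₁}v)(t) ≤ liminf (v_ε, χ_{B₁}v_ε)
  ≤ 2α₀`", "`∫_{1/k}^T∫_{B₁}|∇v|² ≤ sup_ε ∫₀ᵀ∫_{B₁}|∇v_ε|²`", "since `π_ε ∈ L^{3/2}(0,T;L^{3/2}(B₁))`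
  with uniformly bounded norms, it follows that `π ∈ L^{3/2}(0,T;L^{3/2}(B₁))`").
* `bradshawTsai2019_prop_3_1_dss_of_scheme`, `bradshawTsai2019_prop_3_1_of_scheme` (**proved**,
  the assembly): the scheme fact implies `bradshawTsai2019_prop_3_1_dss`, hence
  `bradshawTsai2019_prop_3_1`, with the explicit choices `a = M + 1`,
  `T = (1 + 2C₀(2 + 8a²))⁻¹`, `C = 2a + (a + C₀T(8a³ + 2a)) + C₀(a + T(8a³ + 2a))` serving all data
  with `‖v₀‖²_{L²(B_λ)} ≤ M` (the uniformity in the datum used in §4.3).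

The trust base of Prop. 3.1 in the tree thereby becomes the single, precisely delimited analytic
input `bradshawTsai2019_prop_3_1_scheme` ([BT1]'s construction with the estimates (3.5)–(3.12)
and the lower semicontinuity of the three functionals along it); the bookkeeping with `T(α₀, λ)`,
`C(α₀, λ)` and the bootstrap are proved.

## Design notes

* *Local energies.* `BradshawTsai2019.ballEnergy u t = ∫⁻_{B₁} ‖u t‖ₑ²` (`α(t)`, valued in
  `ℝ≥0∞`) and `BradshawTsai2019.supBallEnergy u s = ⨆_{0<τ≤s} ballEnergy u τ` (`α̃(s)`; the
  printed `sup_{0≤τ≤s}` includes `τ = 0` with `α_ε(0) = ∫_{B₁}|v₀|²`, which does not change the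
  supremum of a function right-continuous at `0`) are `abbrev`s. The continuity of `α_ε` ("because
  each `v_ε` is smooth on `ℝ³ × (0,∞)` and right continuous in `L²_loc` at `t = 0`") is recorded as
  `ContinuousOn … (Ioi 0)` in `ℝ≥0∞` plus the right limit at `0`; the integral `∫₀ᵗ(α̃³ + α̃) ds` is
  the lower Lebesgue integral over `Ioo 0 t` (`α̃` is monotone, hence measurable).
* *Which properties of the scheme are recorded.* Of the printed properties of `v_ε` (smooth
  `λ`-DSS solutions of the mollified system (3.5) with the normalised pressure (3.8), converging to
  `v` weakly in `L²(0,T;H¹(K))`, strongly in `L²(0,T;L²(K))` and weakly in `L²(K)` at every time)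
  the fact keeps exactly the consequences the printed argument consumes after (3.12): continuity
  of `α_ε`, its initial value, (3.12), the pressure bound, and the three lower-semicontinuity
  transfers — an existential statement strictly weaker than the printed one. The approximants are
  indexed by `k ∈ ℕ` ([BT1], proof of Thm 2.4: "a sequence `{U_{ε_k}}`"; (3.9)–(3.12) hold "for `ε`
  sufficiently small", i.e. along a tail of the sequence).
* *The pressure bound.* Printed are the three bounds for `−⅓(η_{ε√t}*v_ε)·v_ε`, `π_near`, `π_far`
  in `L^{3/2}(0,t;L^{3/2}(B_λ))` by `C∫₀ᵗ(α̃³ + α̃) + γ∫₀ᵗ∫|∇v_ε|²φ` (p. 10) and the energy bound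
  `∫₀ᵗ∫|∇v_ε|²φ ≤ α₀ + C∫₀ᵗ(α̃³ + α̃)` behind (3.12); together:
  `∫₀ᵗ∫_{B₁}|π_ε|^{3/2} ≤ C₀(α₀ + ∫₀ᵗ(α̃³ + α̃))`, the form recorded ("`π_ε ∈ L^{3/2}(0,T;L^{3/2}(B₁))`
  with uniformly bounded norms").
* *The pressure is `λ`-DSS.* [BT1] §4 defines `π(x,t) = p(y,s)/(2t)` from the time-periodic `p`,
  which is the identity `λ²π(λ²t, λx) = π(t, x)` (`nsRescalePressure`); cf. the module docstring of
  `ForwardDSSExistenceLocal.lean`, "Why the pressures are assumed DSS".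
* Strict `<` in print is `≤` (constants are existential); `esssup` is an `∀ᵐ t ∈ (0,T)` bound.

## References

* Z. Bradshaw, T.-P. Tsai, *Discretely self-similar solutions to the Navier–Stokes equations with
  data in `L²_loc` satisfying the local energy inequality*, Analysis & PDE 12 (2019) 1943–1962 =
  arXiv:1801.08060, §3: Prop. 3.1, (3.4)–(3.14) and the closing paragraph of its proof (arXiv
  pp. 8–10) [BradshawTsai2019].
* Z. Bradshaw, T.-P. Tsai, *Forward discretely self-similar solutions of the Navier–Stokes
  equations II*, Ann. Henri Poincaré 18 (2017) 1095–1119 = arXiv:1510.07504: Thm 1.2, proof of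
  Thm 2.4 (the mollified scheme and the sequence `ε_k → 0`), §4 (definition of `(v, π)`)
  [BradshawTsai2017AHP].
-/

noncomputable section

open MeasureTheory Set Function Filter Topology TopologicalSpace Metric
open scoped NNReal ENNReal

namespace Literature.Analysis.FluidPDE

/-- Local notation for physical space `ℝ³ = EuclideanSpace ℝ (Fin 3)`. -/
local notation "ℝ³" => EuclideanSpace ℝ (Fin 3)

namespace BradshawTsai2019

/-! ## Local energies on the unit ball -/

/-- The local energy on the unit ball, `α(t) = ∫_{B₁} |u(x,t)|² dx` (Bradshaw–Tsai 2019, §3: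
`α_ε(t) = ∫_{B₁}|v_ε(x,t)|² dx`), valued in `ℝ≥0∞`. [cite: BradshawTsai2019, §3 (proof of Prop 3.1)] -/
abbrev ballEnergy (u : ℝ → ℝ³ → ℝ³) (t : ℝ) : ℝ≥0∞ :=
  ∫⁻ x in ball (0 : ℝ³) 1, ‖u t x‖ₑ ^ 2

/-- The running supremum of the local energy, `α̃(s) = sup_{0<τ≤s} α(τ)` (Bradshaw–Tsai 2019, §3:
`α̃_ε(t) = sup_{0≤τ≤t} α_ε(τ)`; the endpoint `τ = 0`, where `α_ε(0) = ∫_{B₁}|v₀|²` is the right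
limit, does not change the supremum). [cite: BradshawTsai2019, §3 (proof of Prop 3.1)] -/
abbrev supBallEnergy (u : ℝ → ℝ³ → ℝ³) (s : ℝ) : ℝ≥0∞ :=
  ⨆ τ ∈ Ioc (0 : ℝ) s, ballEnergy u τ

/-- `α(τ) ≤ α̃(s)` for `0 < τ ≤ s`. [folklore] -/
theorem ballEnergy_le_supBallEnergy (u : ℝ → ℝ³ → ℝ³) {τ s : ℝ} (hτ : τ ∈ Ioc 0 s) :
    ballEnergy u τ ≤ supBallEnergy u s :=
  le_iSup₂ (f := fun τ (_ : τ ∈ Ioc (0 : ℝ) s) => ballEnergy u τ) τ hτ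

/-- `α̃` is monotone. [folklore] -/
theorem supBallEnergy_mono (u : ℝ → ℝ³ → ℝ³) {s s' : ℝ} (h : s ≤ s') :
    supBallEnergy u s ≤ supBallEnergy u s' :=
  iSup₂_le fun _ hτ => ballEnergy_le_supBallEnergy u ⟨hτ.1, hτ.2.trans h⟩

/-! ## The continuity argument (3.13) ⇒ (3.14) -/

/-- **The continuity argument of Bradshaw–Tsai 2019, (3.13) ⇒ (3.14)** (arXiv:1801.08060, p. 10),
in `ℝ≥0∞`-valued form. Let `α : ℝ → [0, ∞]` be continuous on `(0, ∞)` with a right limit at `0`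
that is at most `α₀ ≤ a` (`0 < a < ∞`), and suppose the integral inequality (3.13)
`α(t) ≤ α₀ + C₀ ∫₀ᵗ (α̃(s)³ + α̃(s)) ds` holds for `0 < t ≤ 1`, where `α̃(s) = sup_{0<τ≤s} α(τ)`.
If `0 < T ≤ 1` and `C₀ T (2 + 8a²) < 1`, then `α(t) ≤ 2a` for all `0 < t ≤ T` ("By continuity of
`α_ε(t)`, we have `α̃_ε(t) ≤ 2α₀, ∀ t < T` for some `T > 0`. By a continuity argument, we may take
`T = (C(2 + 8α₀²))⁻¹`"). Proof: at the first time `t₁ ≤ T` with `α(t₁) ≥ 2a` one has `α̃ ≤ 2a` on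
`(0, t₁)`, whence `α(t₁) ≤ a + C₀ t₁ (8a³ + 2a) < 2a`. [cite: BradshawTsai2019, (3.13)–(3.14)] -/
theorem continuity_argument {α : ℝ → ℝ≥0∞} {α₀ a C₀ l : ℝ≥0∞} {T : ℝ} (hT1 : T ≤ 1)
    (ha : α₀ ≤ a) (ha0 : a ≠ 0) (hatop : a ≠ ⊤)
    (hsmall : C₀ * ENNReal.ofReal T * (2 + 8 * a ^ 2) < 1)
    (hcont : ContinuousOn α (Ioi 0)) (hl : l ≤ α₀) (hlim : Tendsto α (𝓝[>] 0) (𝓝 l))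
    (hineq : ∀ t ∈ Ioc (0 : ℝ) 1,
      α t ≤ α₀ + C₀ * ∫⁻ s in Ioo 0 t, ((⨆ τ ∈ Ioc 0 s, α τ) ^ 3 + ⨆ τ ∈ Ioc 0 s, α τ)) :
    ∀ t ∈ Ioc 0 T, α t ≤ 2 * a := by
  have h2a : a < 2 * a := by
    rw [two_mul]; exact ENNReal.lt_add_right hatop ha0
  have hl2a : l < 2 * a := (hl.trans ha).trans_lt h2a
  -- near `t = 0` the energy is below `2a`
  obtain ⟨δ, hδ0, hδ⟩ : ∃ δ > 0, ∀ t ∈ Ioo 0 δ, α t < 2 * a := by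
    have hev : ∀ᶠ t in 𝓝[>] (0 : ℝ), α t < 2 * a := hlim (gt_mem_nhds hl2a)
    obtain ⟨u, hu, hsub⟩ := mem_nhdsGT_iff_exists_Ioo_subset.1 hev
    exact ⟨u, hu, fun t ht => hsub ht⟩
  intro tb htb
  by_contra hbad'
  have hbad : 2 * a < α tb := not_le.1 hbad'
  have htbδ : δ ≤ tb := by
    by_contra h
    exact absurd (hδ tb ⟨htb.1, not_le.1 h⟩) (not_lt.2 hbad.le)
  -- the first crossing time
  set S : Set ℝ := Icc δ T ∩ α ⁻¹' Ici (2 * a) with hS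
  have hSc : IsClosed S :=
    (hcont.mono fun t ht => hδ0.trans_le ht.1).preimage_isClosed_of_isClosed isClosed_Icc
      isClosed_Ici
  have hSne : S.Nonempty := ⟨tb, ⟨htbδ, htb.2⟩, hbad.le⟩
  have hSbdd : BddBelow S := ⟨δ, fun t ht => ht.1.1⟩
  set t₁ := sInf S with ht₁
  have ht₁S : t₁ ∈ S := hSc.csInf_mem hSne hSbdd
  have hδt₁ : δ ≤ t₁ := ht₁S.1.1
  have ht₁T : t₁ ≤ T := ht₁S.1.2
  have ht₁0 : 0 < t₁ := hδ0.trans_le hδt₁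
  have hge : 2 * a ≤ α t₁ := ht₁S.2
  -- below `t₁` the energy is `< 2a`
  have hbelow : ∀ τ ∈ Ioo 0 t₁, α τ < 2 * a := by
    intro τ hτ
    by_cases hτδ : τ < δ
    · exact hδ τ ⟨hτ.1, hτδ⟩
    · by_contra hτa
      have hτS : τ ∈ S := ⟨⟨not_lt.1 hτδ, hτ.2.le.trans ht₁T⟩, not_lt.1 hτa⟩
      exact absurd (csInf_le hSbdd hτS) (not_le.2 hτ.2)
  -- hence the running supremum is `≤ 2a` on `(0, t₁)`
  have hsup : ∀ s ∈ Ioo 0 t₁, (⨆ τ ∈ Ioc 0 s, α τ) ≤ 2 * a := fun s hs =>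
    iSup₂_le fun τ hτ => (hbelow τ ⟨hτ.1, hτ.2.trans_lt hs.2⟩).le
  have hint : ∫⁻ s in Ioo 0 t₁, ((⨆ τ ∈ Ioc 0 s, α τ) ^ 3 + ⨆ τ ∈ Ioc 0 s, α τ) ≤
      ((2 * a) ^ 3 + 2 * a) * ENNReal.ofReal t₁ := by
    calc ∫⁻ s in Ioo 0 t₁, ((⨆ τ ∈ Ioc 0 s, α τ) ^ 3 + ⨆ τ ∈ Ioc 0 s, α τ)
        ≤ ∫⁻ _ in Ioo 0 t₁, ((2 * a) ^ 3 + 2 * a) :=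
          setLIntegral_mono' measurableSet_Ioo fun s hs =>
            add_le_add (pow_le_pow_left' (hsup s hs) 3) (hsup s hs)
      _ = ((2 * a) ^ 3 + 2 * a) * ENNReal.ofReal t₁ := by
          rw [setLIntegral_const, Real.volume_Ioo, sub_zero]
  -- the inequality at `t₁` contradicts `α t₁ ≥ 2a`
  have hkey : α t₁ < 2 * a := by
    have h1 := hineq t₁ ⟨ht₁0, ht₁T.trans hT1⟩
    have hTt : ENNReal.ofReal t₁ ≤ ENNReal.ofReal T := ENNReal.ofReal_le_ofReal ht₁T
    calc α t₁ ≤ α₀ + C₀ * ∫⁻ s in Ioo 0 t₁, ((⨆ τ ∈ Ioc 0 s, α τ) ^ 3 + ⨆ τ ∈ Ioc 0 s, α τ) := h1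
      _ ≤ a + C₀ * (((2 * a) ^ 3 + 2 * a) * ENNReal.ofReal T) := by
          gcongr
          exact hint.trans (mul_le_mul_right hTt _)
      _ = a + a * (C₀ * ENNReal.ofReal T * (2 + 8 * a ^ 2)) := by ring
      _ < a + a * 1 := ENNReal.add_lt_add_left hatop (ENNReal.mul_lt_mul_right ha0 hatop hsmall)
      _ = 2 * a := by rw [mul_one, two_mul]
  exact absurd hge (not_le.2 hkey)

end BradshawTsai2019

open BradshawTsai2019

/-! ## The analytic input: [BT1]'s scheme with the estimate (3.12) -/

/-- **Bradshaw–Tsai 2019, §3, proof of Proposition 3.1: the mollified approximation scheme of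
[BT1] with the local energy estimate (3.12), the pressure bound, and the passage to the limit**
(arXiv:1801.08060, pp. 8–10; [BT1] = Bradshaw–Tsai 2017, Thm 1.2, proof of Thm 2.4, §4). Fix
`λ > 1`. There is a constant `C₀ = C(λ, η, γ)` ((3.12): `η` the mollifier fixed in [BT1],
`γ = γ(λ)` the absorption parameter) such that for every divergence free `λ`-DSS `v₀ ∈ L³_w(ℝ³)`:
"`v` is a `λ`-DSS local Leray solution evolving from `v₀` constructed in [BT1] … and `π` is its
associated pressure" ([BT1] Thm 1.2; `π(x,t) = p(y,s)/(2t)` with `p` time-periodic, [BT1] §4, so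
`π` is a `λ`-DSS pressure), `∇v` its weak gradient on `(0,∞) × ℝ³`; "it is the limit of a mollified
approximation scheme": there are fields `v_ε` (`ε = ε_k → 0`, [BT1] proof of Thm 2.4), pressures
`π_ε` and gradients `∇v_ε` such that — writing `α_ε(t) = ∫_{B₁}|v_ε(x,t)|² dx`,
`α̃_ε(t) = sup_{0≤τ≤t} α_ε(τ)`, `α₀ = ‖v₀‖²_{L²(B_λ)}` —
(i) "because each `v_ε` is smooth on `ℝ³ × (0,∞)` and right continuous in `L²_loc` at `t = 0`,
`α_ε(t)` and `α̃_ε(t)` are continuous as functions of `t`", and "`v_ε(t) → v₀` in `L²_loc`, i.e. the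
mollification does not affect the initial data" (p. 8);
(ii) **(3.12)** "`α_ε(t) + ∫₀ᵗ∫_{B₁}|∇v_ε|² dx ds ≤ α₀ + C(λ,η,γ)∫₀ᵗ(α̃_ε(s)³ + α̃_ε(s)) ds`" for
`0 < t ≤ 1` and `ε` sufficiently small (p. 10, with pp. 8–9: "We will estimate the terms … for
`0 < t ≤ 1`", "By taking `ε` sufficiently small");
(iii) the pressure bound: the three displayed `L^{3/2}(0,t;L^{3/2}(B_λ))`-bounds of p. 10 by
`C(λ,γ,η)∫₀ᵗ(α̃_ε³ + α̃_ε) ds + γ∫₀ᵗ∫|∇v_ε|²φ` together with `∫₀ᵗ∫|∇v_ε|²φ ≤ α₀ + C∫₀ᵗ(α̃_ε³ + α̃_ε)`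
(the absorption step of (3.12)): `∫₀ᵗ∫_{B₁}|π_ε|^{3/2} ≤ C₀(α₀ + ∫₀ᵗ(α̃_ε³ + α̃_ε) ds)`, `0 < t ≤ 1`;
(iv) the passage to the limit (p. 10): "Letting `ε → 0` yields
`(v, χ_{B₁}v)(t) ≤ liminf_{ε→0} (v_ε, χ_{B₁}v_ε)_{L²}(t) ≤ 2α₀` for all `t ≤ T`"; "`v_ε` converges
weakly to `v` in `L²(1/k,T;H¹(B₁))` … Hence `∫_{1/k}^T∫_{B₁}|∇v|² ≤ sup_{ε>0}∫₀ᵀ∫_{B₁}|∇v_ε|²` … letting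
`k → ∞`"; "since `π_ε ∈ L^{3/2}(0,T;L^{3/2}(B₁))` with uniformly bounded norms, it follows that
`π ∈ L^{3/2}(0,T;L^{3/2}(B₁))`" ([BT1]: `p_{ε_k} ⇀ p` weakly in `L^{5/3}`) — rendered as: a bound
obeyed by all approximants on `(0,T] × B₁` is obeyed by the limit (a.e. in `t` for the sliced
energy). Of the printed properties of the scheme exactly these are recorded (module docstring,
"Which properties of the scheme are recorded"); with the proved continuity argument they give
Prop. 3.1 (`bradshawTsai2019_prop_3_1_dss_of_scheme`). **Not proved here.** [cite: BradshawTsai2019, §3 proof of Prop 3.1 ((3.5)–(3.12) and the limit ε → 0)] -/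
def bradshawTsai2019_prop_3_1_scheme : Prop :=
  ∀ {c : ℝ}, 1 < c → ∃ C₀ : ℝ≥0, ∀ {v₀ : ℝ³ → ℝ³},
    FunctionSpaces.MemWeakLp v₀ 3 volume → IsWeaklyDivFree v₀ → nsRescaleData c v₀ = v₀ →
    ∃ (v : ℝ → ℝ³ → ℝ³) (π : ℝ → ℝ³ → ℝ) (G : ℝ → ℝ³ → ℝ³ →L[ℝ] ℝ³),
      -- the [BT1] solution, its pressure and its gradient
      IsLocalLeraySolution 1 v₀ v π ∧ IsDiscretelySelfSimilar c v ∧ nsRescalePressure c π = π ∧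
      HasWeakSpatialGradientOn (slab ℝ³ (Ioi 0) isOpen_Ioi) v G ∧
      -- the mollified approximants `v_ε`, `π_ε`, `∇v_ε`, `ε = ε_k → 0`
      ∃ (w : ℕ → ℝ → ℝ³ → ℝ³) (ϖ : ℕ → ℝ → ℝ³ → ℝ) (H : ℕ → ℝ → ℝ³ → ℝ³ →L[ℝ] ℝ³),
        -- (i) continuity of `α_ε` on `(0, ∞)` and its right limit `∫_{B₁}|v₀|²` at `t = 0`
        (∀ k, ContinuousOn (ballEnergy (w k)) (Ioi 0)) ∧
        (∀ k, Tendsto (ballEnergy (w k)) (𝓝[>] 0) (𝓝 (∫⁻ x in ball (0 : ℝ³) 1, ‖v₀ x‖ₑ ^ 2))) ∧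
        (∀ k, HasWeakSpatialGradientOn (slab ℝ³ (Ioi 0) isOpen_Ioi) (w k) (H k)) ∧
        -- (ii) the local energy inequality (3.12), `0 < t ≤ 1`
        (∀ k, ∀ t : ℝ, 0 < t → t ≤ 1 →
          ballEnergy (w k) t +
              ∫⁻ z in Ioo 0 t ×ˢ ball (0 : ℝ³) 1, ENNReal.ofReal (frobeniusNormSq (H k z.1 z.2)) ≤
            (∫⁻ x in ball (0 : ℝ³) c, ‖v₀ x‖ₑ ^ 2) +
              C₀ * ∫⁻ s in Ioo 0 t, (supBallEnergy (w k) s ^ 3 + supBallEnergy (w k) s)) ∧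
        -- (iii) the pressure bound, `0 < t ≤ 1`
        (∀ k, ∀ t : ℝ, 0 < t → t ≤ 1 →
          ∫⁻ z in Ioo 0 t ×ˢ ball (0 : ℝ³) 1, ‖ϖ k z.1 z.2‖ₑ ^ (3 / 2 : ℝ) ≤
            C₀ * ((∫⁻ x in ball (0 : ℝ³) c, ‖v₀ x‖ₑ ^ 2) +
              ∫⁻ s in Ioo 0 t, (supBallEnergy (w k) s ^ 3 + supBallEnergy (w k) s))) ∧
        -- (iv) passage to the limit `ε → 0`: sliced energy, dissipation, pressure
        (∀ T : ℝ, 0 < T → ∀ B : ℝ≥0∞, (∀ k, ∀ t ∈ Ioc 0 T, ballEnergy (w k) t ≤ B) →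
          ∀ᵐ t ∂(volume.restrict (Ioo 0 T)), ballEnergy v t ≤ B) ∧
        (∀ T : ℝ, 0 < T → ∀ B : ℝ≥0∞,
          (∀ k, ∫⁻ z in Ioo 0 T ×ˢ ball (0 : ℝ³) 1,
            ENNReal.ofReal (frobeniusNormSq (H k z.1 z.2)) ≤ B) →
          ∫⁻ z in Ioo 0 T ×ˢ ball (0 : ℝ³) 1, ENNReal.ofReal (frobeniusNormSq (G z.1 z.2)) ≤ B) ∧
        (∀ T : ℝ, 0 < T → ∀ B : ℝ≥0∞,
          (∀ k, ∫⁻ z in Ioo 0 T ×ˢ ball (0 : ℝ³) 1, ‖ϖ k z.1 z.2‖ₑ ^ (3 / 2 : ℝ) ≤ B) →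
          ∫⁻ z in Ioo 0 T ×ˢ ball (0 : ℝ³) 1, ‖π z.1 z.2‖ₑ ^ (3 / 2 : ℝ) ≤ B)

/-! ## The assembly: scheme + continuity argument ⟹ Proposition 3.1 -/

/-- **Assembly of Bradshaw–Tsai 2019, Prop. 3.1 (with the DSS pressure clause) from the scheme
fact and the proved continuity argument** (arXiv:1801.08060, p. 10): given `M`, put `a = M + 1`,
`T = (1 + 2C₀(2 + 8a²))⁻¹ ≤ 1` (so that `C₀T(2 + 8a²) < 1`) and
`C = 2a + (a + C₀T(8a³ + 2a)) + C₀(a + T(8a³ + 2a))`. For a datum with `α₀ = ‖v₀‖²_{L²(B_λ)} ≤ M`,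
(3.12) and the continuity argument give `α̃_ε ≤ 2a` on `(0, T]` for every approximant ((3.14)),
whence `∫₀ᵀ∫_{B₁}|∇v_ε|² ≤ a + C₀T(8a³ + 2a)` by (3.12) and `∫₀ᵀ∫_{B₁}|π_ε|^{3/2} ≤ C₀(a + T(8a³ + 2a))`
by the pressure bound, uniformly in `ε`; the three bounds pass to the limit `(v, π)`. [cite: BradshawTsai2019, Prop 3.1 (proof p. 10)] -/
theorem bradshawTsai2019_prop_3_1_dss_of_scheme (h : bradshawTsai2019_prop_3_1_scheme) :
    bradshawTsai2019_prop_3_1_dss := by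
  intro c hc M
  obtain ⟨C₀, hC₀⟩ := h hc
  -- the constants `a`, `T`, and the smallness `C₀ T (2 + 8a²) < 1`
  set a : ℝ≥0 := M + 1 with ha_def
  have ha0 : a ≠ 0 := by rw [ha_def]; exact (lt_of_lt_of_le one_pos le_add_self).ne'
  set D : ℝ≥0 := 1 + 2 * (C₀ * (2 + 8 * a ^ 2)) with hD_def
  have hD1 : 1 ≤ D := by rw [hD_def]; exact le_self_add
  have hD0 : 0 < D := one_pos.trans_le hD1
  set Tn : ℝ≥0 := D⁻¹ with hTn_def
  have hTn0 : 0 < Tn := inv_pos.2 hD0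
  have hTn1 : Tn ≤ 1 := inv_le_one_of_one_le₀ hD1
  have hsmallN : C₀ * Tn * (2 + 8 * a ^ 2) < 1 := by
    rw [← NNReal.coe_lt_coe, hTn_def, hD_def]
    push_cast
    rw [mul_right_comm, ← div_eq_mul_inv, div_lt_one (by positivity)]
    nlinarith [mul_nonneg (NNReal.coe_nonneg C₀) (by positivity : (0 : ℝ) ≤ 2 + 8 * (a : ℝ) ^ 2)]
  set T : ℝ := (Tn : ℝ) with hT_def
  have hT0 : 0 < T := NNReal.coe_pos.2 hTn0
  have hT1 : T ≤ 1 := by rw [hT_def, ← NNReal.coe_one]; exact NNReal.coe_le_coe.2 hTn1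
  have hTE : ENNReal.ofReal T = (Tn : ℝ≥0∞) := ENNReal.ofReal_coe_nnreal
  have hsmall : (C₀ : ℝ≥0∞) * ENNReal.ofReal T * (2 + 8 * (a : ℝ≥0∞) ^ 2) < 1 := by
    rw [hTE]
    have h1 := ENNReal.coe_lt_coe.2 hsmallN
    push_cast at h1
    exact h1
  -- the bounds: `2a` (energy), `a + C₀ T (8a³ + 2a)` (dissipation), `C₀ (a + T (8a³ + 2a))` (pressure)
  set I : ℝ≥0∞ := (Tn : ℝ≥0∞) * ((2 * (a : ℝ≥0∞)) ^ 3 + 2 * (a : ℝ≥0∞)) with hI_def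
  set B : ℝ≥0∞ := 2 * (a : ℝ≥0∞) + ((a : ℝ≥0∞) + C₀ * I) + C₀ * ((a : ℝ≥0∞) + I) with hB_def
  have hItop : I ≠ ⊤ := ENNReal.mul_ne_top ENNReal.coe_ne_top
    (ENNReal.add_ne_top.2 ⟨ENNReal.pow_ne_top (ENNReal.mul_ne_top ENNReal.ofNat_ne_top
      ENNReal.coe_ne_top), ENNReal.mul_ne_top ENNReal.ofNat_ne_top ENNReal.coe_ne_top⟩)
  have hBtop : B ≠ ⊤ := ENNReal.add_ne_top.2 ⟨ENNReal.add_ne_top.2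
    ⟨ENNReal.mul_ne_top ENNReal.ofNat_ne_top ENNReal.coe_ne_top,
      ENNReal.add_ne_top.2 ⟨ENNReal.coe_ne_top, ENNReal.mul_ne_top ENNReal.coe_ne_top hItop⟩⟩,
    ENNReal.mul_ne_top ENNReal.coe_ne_top (ENNReal.add_ne_top.2 ⟨ENNReal.coe_ne_top, hItop⟩)⟩
  have hB1 : 2 * (a : ℝ≥0∞) ≤ B := le_add_right le_self_add
  have hB2 : (a : ℝ≥0∞) + C₀ * I ≤ B := le_add_right le_add_self
  have hB3 : (C₀ : ℝ≥0∞) * ((a : ℝ≥0∞) + I) ≤ B := le_add_self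
  refine ⟨T, hT0, B.toNNReal, fun {v₀} hw hdiv hdss hM => ?_⟩
  rw [ENNReal.coe_toNNReal hBtop]
  obtain ⟨v, π, G, hLL, hdssv, hdssπ, hG, w, ϖ, H, hcont, hlim, -, hen, hpr, htv, htG, htπ⟩ :=
    hC₀ hw hdiv hdss
  -- `α₀ ≤ M ≤ a` and `∫_{B₁}|v₀|² ≤ α₀`
  have hMa : ((M : ℝ≥0) : ℝ≥0∞) ≤ (a : ℝ≥0∞) := by rw [ha_def]; push_cast; exact le_self_add
  have hα₀a : ∫⁻ x in ball (0 : ℝ³) c, ‖v₀ x‖ₑ ^ 2 ≤ (a : ℝ≥0∞) := hM.trans hMa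
  have hl : ∫⁻ x in ball (0 : ℝ³) 1, ‖v₀ x‖ₑ ^ 2 ≤ ∫⁻ x in ball (0 : ℝ³) c, ‖v₀ x‖ₑ ^ 2 :=
    lintegral_mono_set (ball_subset_ball hc.le)
  -- (3.14): the continuity argument for each approximant
  have hboot : ∀ k, ∀ t ∈ Ioc 0 T, ballEnergy (w k) t ≤ 2 * (a : ℝ≥0∞) := fun k =>
    continuity_argument hT1 hα₀a (ENNReal.coe_ne_zero.2 ha0) ENNReal.coe_ne_top hsmall (hcont k)
      hl (hlim k) fun t ht => le_trans le_self_add (hen k t ht.1 ht.2)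
  have hsup : ∀ k, ∀ s ∈ Ioc 0 T, supBallEnergy (w k) s ≤ 2 * (a : ℝ≥0∞) := fun k s hs =>
    iSup₂_le fun τ hτ => hboot k τ ⟨hτ.1, hτ.2.trans hs.2⟩
  have hint : ∀ k, ∫⁻ s in Ioo 0 T, (supBallEnergy (w k) s ^ 3 + supBallEnergy (w k) s) ≤ I := by
    intro k
    calc ∫⁻ s in Ioo 0 T, (supBallEnergy (w k) s ^ 3 + supBallEnergy (w k) s)
        ≤ ∫⁻ _ in Ioo 0 T, ((2 * (a : ℝ≥0∞)) ^ 3 + 2 * (a : ℝ≥0∞)) :=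
          setLIntegral_mono' measurableSet_Ioo fun s hs =>
            add_le_add (pow_le_pow_left' (hsup k s ⟨hs.1, hs.2.le⟩) 3) (hsup k s ⟨hs.1, hs.2.le⟩)
      _ = I := by
          rw [setLIntegral_const, Real.volume_Ioo, sub_zero, hTE, mul_comm]
  -- uniform dissipation and pressure bounds for the approximants on `(0, T) × B₁`
  have hHk : ∀ k, ∫⁻ z in Ioo 0 T ×ˢ ball (0 : ℝ³) 1,
      ENNReal.ofReal (frobeniusNormSq (H k z.1 z.2)) ≤ (a : ℝ≥0∞) + C₀ * I := fun k =>
    calc ∫⁻ z in Ioo 0 T ×ˢ ball (0 : ℝ³) 1, ENNReal.ofReal (frobeniusNormSq (H k z.1 z.2))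
        ≤ ballEnergy (w k) T + ∫⁻ z in Ioo 0 T ×ˢ ball (0 : ℝ³) 1,
            ENNReal.ofReal (frobeniusNormSq (H k z.1 z.2)) := le_add_self
      _ ≤ (∫⁻ x in ball (0 : ℝ³) c, ‖v₀ x‖ₑ ^ 2) +
            C₀ * ∫⁻ s in Ioo 0 T, (supBallEnergy (w k) s ^ 3 + supBallEnergy (w k) s) :=
          hen k T hT0 hT1
      _ ≤ (a : ℝ≥0∞) + C₀ * I := add_le_add hα₀a (mul_le_mul_right (hint k) _)
  have hϖk : ∀ k, ∫⁻ z in Ioo 0 T ×ˢ ball (0 : ℝ³) 1, ‖ϖ k z.1 z.2‖ₑ ^ (3 / 2 : ℝ) ≤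
      (C₀ : ℝ≥0∞) * ((a : ℝ≥0∞) + I) := fun k =>
    (hpr k T hT0 hT1).trans (mul_le_mul_right (add_le_add hα₀a (hint k)) _)
  -- passage to the limit
  have h1 := htv T hT0 (2 * (a : ℝ≥0∞)) fun k t ht => hboot k t ht
  have h2 := htG T hT0 _ hHk
  have h3 := htπ T hT0 _ hϖk
  exact ⟨v, π, hLL, hdssv, hdssπ, h1.mono fun t ht => ht.trans hB1, ⟨G, hG, h2.trans hB2⟩,
    h3.trans hB3⟩

/-- **Assembly of Bradshaw–Tsai 2019, Prop. 3.1 as rendered in `ForwardDSSExistence.lean`** from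
the scheme fact (forget the DSS invariance of the pressure,
`bradshawTsai2019_prop_3_1_dss.prop_3_1`). Hence the trust base of `bradshawTsai2019_prop_3_1`
is `{bradshawTsai2019_prop_3_1_scheme}`. [cite: BradshawTsai2019, Prop 3.1 (proof p. 10)] -/
theorem bradshawTsai2019_prop_3_1_of_scheme (h : bradshawTsai2019_prop_3_1_scheme) :
    bradshawTsai2019_prop_3_1 := by
  have h' : bradshawTsai2019_prop_3_1_dss := bradshawTsai2019_prop_3_1_dss_of_scheme h
  intro c hc M
  exact bradshawTsai2019_prop_3_1_dss.prop_3_1 h' hc M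

end Literature.Analysis.FluidPDE

end
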